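import Mathlib
import Summits.ResolutionOfSingularities.ResolutionOfSingularities.Theorems.HomologicalConductorNoZenoStableAnnihilatorReduction
import Summits.ResolutionOfSingularities.ResolutionOfSingularities.Theorems.HomologicalConductorPersistenceSurfaceHullCover
import HarnessLib

/-!
# Crux `Persistence` (stmt-ResolutionOfSingularities-16484) / rung S-2 `PersistenceSurface` (stmt-19970) —
# the INVOLUTION TRANSFER lemmas for stable annihilators along a `μ₂`-quotient `U = V^σ`
# (chain W4.4b, seat res-L1-w44b-stub-4 gen 3, memo `L/res-L1-w44b-stub-4/SIGMA6b.md` §2)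

[OURS · L1 w44b · Σ6] Nothing here is a statement of the manuscript under review (Hironaka 2017); AI-written,
weaker than expert review.

SETTING. `U → V` commutative rings, `σ : V →ₐ[U] V` an involution whose fixed ring is (the image of) `U`
(`algebraMap U V` injective with range `{v | σ v = v}`), `2` a unit of `U`; `M` a `V`-module with a
`σ`-semilinear involution `τ` (`τ (v • m) = σ v • τ m`), and `j : N →ₗ[U] M` an injective `U`-linear map whose
range is the `τ`-fixed vectors (`N ≅ M^τ`, the module of invariants).  This is the algebra of a double cover
`Spec V → Spec U = Spec V / μ₂` (char `≠ 2`) and of a `V ⋊ μ₂`-module `M` with invariant `U`-module `N`; in the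
W4.4b census of the crux it is the shape of EVERY x-chart of a double point `x² + g(y,z)` blown up along
`(x) + cond(g)` (`U_x(E₁₂)`, `U_x(Ẽ₈)`, `U_x(x²+y³+z¹³)` are all `V^{μ₂}` over the `A₁`-cone `k[s,t]^{μ₂}`).

RESULTS (free-factorisation form `π ∘ ι = x • id` through `Fin s → ·`, and `StablyAnnihilates` form via the
bridge `stablyAnnihilates_iff_exists_linearMap` of `…PersistenceSurfaceHullCover`):
* `exists_comp_eq_smul_id_of_add` — two free factorisations summing to `y • id` give one free factorisation
  of `y • id` (through `Fin (s + t)`).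
* `exists_comp_eq_smul_id_fixed_of_equivariant` — CORE: if `G₁ ∘ F₁ + G₂ ∘ F₂ = w • id_M` with `V`-linear
  `F_i : M → Vˢ`, `G_i : Vˢ → M` that are EQUIVARIANT (`F_i (τ m) = σ ∘ F_i m`, `τ (G_i x) = G_i (σ ∘ x)`) and
  `algebraMap u = w`, then `u • id_N` factors `U`-linearly through a finite free `U`-module (restrict to
  invariants: `(Vˢ)^σ = Uˢ`).
* `exists_comp_eq_smul_id_fixed_of_anti` — ODD–ODD TRANSFER: a free `V`-factorisation `g ∘ f = c • id_M` with
  `σ c = -c`, and any `a` with `σ a = -a`, give a free `U`-factorisation of `u • id_N` for `algebraMap u = a * c`.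
  Proof: with `fσ m = σ ∘ f (τ m)`, `gσ x = τ (g (σ ∘ x))` one has `gσ ∘ fσ = σ c • id`, and
  `(g + gσ) ∘ (a • (f - fσ)) + (a • (g - gσ)) ∘ (f + fσ) = 2a(c - σ c) • id = 4ac • id` with all four maps
  equivariant; divide by `4 ∈ Uˣ`.
* `exists_comp_eq_smul_id_fixed_of_even` — EVEN (AVERAGING) TRANSFER: `σ c = c`, `σ a = -a`, `σ b = -b` give a
  free `U`-factorisation of `u • id_N` for `algebraMap u = a * b * c`
  (`(g + gσ) ∘ (ab • (f + fσ)) + (a • (g - gσ)) ∘ (b • (f - fσ)) = 4abc • id`).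
* `StablyAnnihilates.fixed_of_anti` / `StablyAnnihilates.fixed_of_even` — the same in the CA-layer vocabulary:
  `StablyAnnihilates V c M → StablyAnnihilates U u N`.

APPLICATION (memo SIGMA6b §2, not formalised here: it needs `ca(V) ⊇ (z′) + cond(g)·V` (Knörrer + Esentepe) and
Auslander's reflexive correspondence `MCM(U) = MCM(V)^{μ₂}`): for `U = U_x(E₁₂) = V^{μ₂}`,
`V = k[s,t,z′]/(z′² + t(s³ − t⁷/4))`, the odd element `t⁵ ∈ cond ⊆ ca(V)` and the odd scalar `t` give
`r³ = t·t⁵ ∈ ca(U)`; with the even transfer (`(p,q,r)·(ca V)^σ ⊆ ca U`, stub-4 g2) this yields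
`U_{≥9} ⊆ ca(U) ⊆ U_{≥8}`, leaving the single open class `qr = st³`.

References: Iyengar–Takahashi, IMRN 2016, arXiv:1404.1476, Remark 2.13 (stable annihilation)
[`IyengarTakahashi2014`]; the parity split is folklore (Reynolds operator for a group of order 2).
-/

-- single-problem summit: the doubled namespace component `ResolutionOfSingularities` is forced
set_option linter.dupNamespace false

noncomputable section

open CategoryTheory Literature.RingTheory.CohomologyAnnihilator
open Summit.ResolutionOfSingularities.ResolutionOfSingularities.Theorems.NoZeno.SandwichCluster
open Summit.ResolutionOfSingularities.ResolutionOfSingularities.Theorems.HomologicalConductor.PersistenceSurfaceHullCover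

universe u

namespace Summit.ResolutionOfSingularities.ResolutionOfSingularities.Theorems.HomologicalConductor.PersistenceInvolutionTransfer

/-! ## Sums of free factorisations -/

/-- Two free factorisations `β₁ ∘ α₁` (through `Fin s → C`) and `β₂ ∘ α₂` (through `Fin t → C`) with
`β₁ ∘ α₁ + β₂ ∘ α₂ = y • id` combine into ONE free factorisation of `y • id` through `Fin (s + t) → C`
(`X → Cˢ × Cᵗ ≅ C^{s+t} → X`). [folklore] -/
theorem exists_comp_eq_smul_id_of_add {C : Type u} [CommRing C] {X : Type u} [AddCommGroup X] [Module C X]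
    {y : C} {s t : ℕ} (α₁ : X →ₗ[C] (Fin s → C)) (β₁ : (Fin s → C) →ₗ[C] X) (α₂ : X →ₗ[C] (Fin t → C))
    (β₂ : (Fin t → C) →ₗ[C] X) (h : β₁ ∘ₗ α₁ + β₂ ∘ₗ α₂ = y • LinearMap.id) :
    ∃ (α : X →ₗ[C] (Fin (s + t) → C)) (β : (Fin (s + t) → C) →ₗ[C] X), β ∘ₗ α = y • LinearMap.id := by
  -- `e : (Fin s → C) × (Fin t → C) ≃ (Fin (s+t) → C)`
  let e : ((Fin s → C) × (Fin t → C)) ≃ₗ[C] (Fin (s + t) → C) :=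
    (LinearEquiv.sumArrowLequivProdArrow (Fin s) (Fin t) C C).symm ≪≫ₗ
      (LinearEquiv.funCongrLeft C C finSumFinEquiv.symm)
  refine ⟨e.toLinearMap ∘ₗ (α₁.prod α₂), (β₁.coprod β₂) ∘ₗ e.symm.toLinearMap, ?_⟩
  calc (β₁.coprod β₂ ∘ₗ e.symm.toLinearMap) ∘ₗ (e.toLinearMap ∘ₗ α₁.prod α₂)
      = β₁.coprod β₂ ∘ₗ ((e.symm.toLinearMap ∘ₗ e.toLinearMap) ∘ₗ α₁.prod α₂) := by
        simp only [LinearMap.comp_assoc]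
    _ = β₁.coprod β₂ ∘ₗ α₁.prod α₂ := by
        rw [LinearEquiv.symm_comp, LinearMap.id_comp]
    _ = y • LinearMap.id := by rw [LinearMap.coprod_comp_prod, h]

/-! ## The core: equivariant factorisations restrict to the invariants -/

section Core

variable {U V : Type u} [CommRing U] [CommRing V] [Algebra U V]
variable {M : Type u} [AddCommGroup M] [Module V M] [Module U M] [IsScalarTower U V M]
variable {N : Type u} [AddCommGroup N] [Module U N]

/-- **Core restriction lemma.** Let `σ : V →ₐ[U] V` have fixed ring exactly `algebraMap U V '' U` (injective
`algebraMap`), `τ : M →+ M` be `σ`-semilinear, and `j : N →ₗ[U] M` be injective with range the `τ`-fixed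
vectors.  If `V`-linear maps `F₁ F₂ : M → (Fin s → V)`, `G₁ G₂ : (Fin s → V) → M` are equivariant
(`F_i (τ m) = σ ∘ F_i m`, `τ (G_i x) = G_i (σ ∘ x)`) and `G₁ (F₁ m) + G₂ (F₂ m) = w • m` with
`algebraMap U V u = w`, then `u • id_N` factors `U`-linearly through a finite free `U`-module: the `F_i` send
invariants to `σ`-fixed vectors `= Uˢ`, the `G_i` send `Uˢ` to invariants. [folklore] -/
theorem exists_comp_eq_smul_id_fixed_of_equivariant (σ : V →ₐ[U] V)
    (hfix : ∀ v : V, σ v = v → ∃ u : U, algebraMap U V u = v) (hinj : Function.Injective (algebraMap U V))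
    (τ : M →+ M) (j : N →ₗ[U] M) (hjinj : Function.Injective j) (hjτ : ∀ n, τ (j n) = j n)
    (hjsurj : ∀ m, τ m = m → ∃ n, j n = m) {s : ℕ} (F₁ F₂ : M →ₗ[V] (Fin s → V))
    (G₁ G₂ : (Fin s → V) →ₗ[V] M) (hF₁ : ∀ m i, F₁ (τ m) i = σ (F₁ m i))
    (hF₂ : ∀ m i, F₂ (τ m) i = σ (F₂ m i)) (hG₁ : ∀ x, τ (G₁ x) = G₁ (fun i => σ (x i)))
    (hG₂ : ∀ x, τ (G₂ x) = G₂ (fun i => σ (x i))) {w : V} (hsum : ∀ m, G₁ (F₁ m) + G₂ (F₂ m) = w • m)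
    (u : U) (hu : algebraMap U V u = w) :
    ∃ (t : ℕ) (f' : N →ₗ[U] (Fin t → U)) (g' : (Fin t → U) →ₗ[U] N), g' ∘ₗ f' = u • LinearMap.id := by
  classical
  -- choice of preimages in `U` of `σ`-fixed elements, and in `N` of `τ`-fixed vectors
  choose φ hφ using hfix
  choose ρ hρ using hjsurj
  -- fixedness of the coordinates of `F_i (j n)` and of `G_i (algebraMap ∘ x)`
  have hF₁fix : ∀ n i, σ (F₁ (j n) i) = F₁ (j n) i := fun n i => by rw [← hF₁, hjτ]
  have hF₂fix : ∀ n i, σ (F₂ (j n) i) = F₂ (j n) i := fun n i => by rw [← hF₂, hjτ]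
  have hGfix : ∀ (G : (Fin s → V) →ₗ[V] M), (∀ x, τ (G x) = G (fun i => σ (x i))) →
      ∀ x : Fin s → U, τ (G (fun i => algebraMap U V (x i))) = G (fun i => algebraMap U V (x i)) := by
    intro G hG x
    rw [hG]
    simp only [AlgHom.commutes]
  -- the restricted maps
  let f₁ : N →ₗ[U] (Fin s → U) :=
    { toFun := fun n i => φ (F₁ (j n) i) (hF₁fix n i)
      map_add' := fun n n' => by
        funext i
        apply hinj
        simp only [Pi.add_apply, map_add, hφ]
      map_smul' := fun c n => by
        funext i
        apply hinj
        simp only [Pi.smul_apply, smul_eq_mul, map_mul, RingHom.id_apply, hφ, LinearMap.map_smul_of_tower]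
        exact Algebra.smul_def c _ }
  let f₂ : N →ₗ[U] (Fin s → U) :=
    { toFun := fun n i => φ (F₂ (j n) i) (hF₂fix n i)
      map_add' := fun n n' => by
        funext i
        apply hinj
        simp only [Pi.add_apply, map_add, hφ]
      map_smul' := fun c n => by
        funext i
        apply hinj
        simp only [Pi.smul_apply, smul_eq_mul, map_mul, RingHom.id_apply, hφ, LinearMap.map_smul_of_tower]
        exact Algebra.smul_def c _ }
  have hι : ∀ (x y : Fin s → U), (fun i => algebraMap U V ((x + y) i)) =
      (fun i => algebraMap U V (x i)) + (fun i => algebraMap U V (y i)) := fun x y => by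
    funext i; simp
  have hιs : ∀ (c : U) (x : Fin s → U), (fun i => algebraMap U V ((c • x) i)) =
      algebraMap U V c • (fun i => algebraMap U V (x i)) := fun c x => by
    funext i; simp
  let g₁ : (Fin s → U) →ₗ[U] N :=
    { toFun := fun x => ρ (G₁ (fun i => algebraMap U V (x i))) (hGfix G₁ hG₁ x)
      map_add' := fun x y => by
        apply hjinj
        rw [map_add, hρ, hρ, hρ, hι, map_add]
      map_smul' := fun c x => by
        apply hjinj
        rw [LinearMap.map_smul_of_tower, hρ, hρ, RingHom.id_apply, hιs, map_smul, algebraMap_smul] }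
  let g₂ : (Fin s → U) →ₗ[U] N :=
    { toFun := fun x => ρ (G₂ (fun i => algebraMap U V (x i))) (hGfix G₂ hG₂ x)
      map_add' := fun x y => by
        apply hjinj
        rw [map_add, hρ, hρ, hρ, hι, map_add]
      map_smul' := fun c x => by
        apply hjinj
        rw [LinearMap.map_smul_of_tower, hρ, hρ, RingHom.id_apply, hιs, map_smul, algebraMap_smul] }
  -- the two restricted factorisations sum to `u • id_N`
  have hf₁ : ∀ n, (fun i => algebraMap U V (f₁ n i)) = F₁ (j n) := fun n => by
    funext i; exact hφ _ _
  have hf₂ : ∀ n, (fun i => algebraMap U V (f₂ n i)) = F₂ (j n) := fun n => by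
    funext i; exact hφ _ _
  have hsumU : g₁ ∘ₗ f₁ + g₂ ∘ₗ f₂ = u • LinearMap.id := by
    apply LinearMap.ext
    intro n
    apply hjinj
    simp only [LinearMap.add_apply, LinearMap.comp_apply, LinearMap.smul_apply, LinearMap.id_apply, map_add,
      LinearMap.map_smul_of_tower]
    change j (ρ _ _) + j (ρ _ _) = u • j n
    rw [hρ, hρ, hf₁, hf₂, hsum, ← hu, algebraMap_smul]
  obtain ⟨α, β, hαβ⟩ := exists_comp_eq_smul_id_of_add f₁ g₁ f₂ g₂ hsumU
  exact ⟨s + s, α, β, hαβ⟩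

end Core

/-! ## The odd–odd and the even (averaging) transfer -/

section Transfer

variable {U V : Type u} [CommRing U] [CommRing V] [Algebra U V]
variable {M : Type u} [AddCommGroup M] [Module V M] [Module U M] [IsScalarTower U V M]
variable {N : Type u} [AddCommGroup N] [Module U N]

omit [Module U M] [IsScalarTower U V M] in
/-- The `σ`-twist `m ↦ σ ∘ f (τ m)` of a `V`-linear map `f : M → Vˢ` along a `σ`-semilinear involution `τ`
is again `V`-linear. [folklore] -/
theorem twist_source_map_smul (σ : V →ₐ[U] V) (hσσ : ∀ v, σ (σ v) = v) (τ : M →+ M)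
    (hτ : ∀ (v : V) (m : M), τ (v • m) = σ v • τ m) {s : ℕ} (f : M →ₗ[V] (Fin s → V)) (v : V) (m : M) :
    (fun i => σ (f (τ (v • m)) i)) = v • (fun i => σ (f (τ m) i)) := by
  funext i
  rw [hτ, map_smul]
  simp [hσσ]

/-- **Odd–odd transfer (free form).** In the setting of `exists_comp_eq_smul_id_fixed_of_equivariant`, with
`σ` an involution, `τ` a `σ`-semilinear involution and `2 ∈ Uˣ`: a free `V`-factorisation `g ∘ f = c • id_M`
with `σ c = -c`, together with any `a ∈ V` with `σ a = -a`, yields a free `U`-factorisation of `u • id_N`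
whenever `algebraMap U V u = a * c`.  (Parity split `f = f₊ + f₋`; `g₊f₋ + g₋f₊ = c • id`; the odd scalar `a`
makes `a f₋`, `a g₋` equivariant.) [folklore] -/
theorem exists_comp_eq_smul_id_fixed_of_anti (σ : V →ₐ[U] V) (hσσ : ∀ v, σ (σ v) = v)
    (hfix : ∀ v : V, σ v = v → ∃ u : U, algebraMap U V u = v) (hinj : Function.Injective (algebraMap U V))
    (h2 : IsUnit (2 : U)) (τ : M →+ M) (hτ : ∀ (v : V) (m : M), τ (v • m) = σ v • τ m)
    (hττ : ∀ m, τ (τ m) = m) (j : N →ₗ[U] M) (hjinj : Function.Injective j) (hjτ : ∀ n, τ (j n) = j n)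
    (hjsurj : ∀ m, τ m = m → ∃ n, j n = m) {c a : V} (hc : σ c = -c) (ha : σ a = -a) {s : ℕ}
    (f : M →ₗ[V] (Fin s → V)) (g : (Fin s → V) →ₗ[V] M) (hgf : g ∘ₗ f = c • LinearMap.id) (u : U)
    (hu : algebraMap U V u = a * c) :
    ∃ (t : ℕ) (f' : N →ₗ[U] (Fin t → U)) (g' : (Fin t → U) →ₗ[U] N), g' ∘ₗ f' = u • LinearMap.id := by
  -- the twisted maps
  let fσ : M →ₗ[V] (Fin s → V) :=
    { toFun := fun m i => σ (f (τ m) i)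
      map_add' := fun m m' => by funext i; simp [map_add]
      map_smul' := fun v m => twist_source_map_smul σ hσσ τ hτ f v m }
  let sF : (Fin s → V) → (Fin s → V) := fun x i => σ (x i)
  have sF_add : ∀ x y, sF (x + y) = sF x + sF y := fun x y => by funext i; simp [sF]
  have sF_smul : ∀ (v : V) x, sF (v • x) = σ v • sF x := fun v x => by funext i; simp [sF]
  have sF_sF : ∀ x, sF (sF x) = x := fun x => by funext i; simp [sF, hσσ]
  let gσ : (Fin s → V) →ₗ[V] M :=
    { toFun := fun x => τ (g (sF x))
      map_add' := fun x y => by simp only [sF_add, map_add]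
      map_smul' := fun v x => by rw [sF_smul, map_smul, hτ, hσσ, RingHom.id_apply] }
  have hgf' : ∀ m, g (f m) = c • m := fun m => by
    simpa using LinearMap.congr_fun hgf m
  have hfσ : ∀ m, fσ m = sF (f (τ m)) := fun m => rfl
  have hgσ : ∀ x, gσ x = τ (g (sF x)) := fun x => rfl
  have hgσfσ : ∀ m, gσ (fσ m) = -(c • m) := fun m => by
    rw [hfσ, hgσ, sF_sF, hgf', hτ, hττ, hc, neg_smul]
  -- the four equivariant maps
  let F₁ : M →ₗ[V] (Fin s → V) := a • (f - fσ)
  let G₁ : (Fin s → V) →ₗ[V] M := g + gσ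
  let F₂ : M →ₗ[V] (Fin s → V) := f + fσ
  let G₂ : (Fin s → V) →ₗ[V] M := a • (g - gσ)
  have hsum : ∀ m, G₁ (F₁ m) + G₂ (F₂ m) = (4 * (a * c)) • m := by
    intro m
    simp only [F₁, G₁, F₂, G₂, LinearMap.smul_apply, LinearMap.sub_apply, LinearMap.add_apply, map_smul,
      map_sub, map_add, smul_sub, smul_add, hgf', hgσfσ]
    module
  have hF₁ : ∀ m i, F₁ (τ m) i = σ (F₁ m i) := by
    intro m i
    simp only [F₁, LinearMap.smul_apply, LinearMap.sub_apply, Pi.smul_apply, Pi.sub_apply, smul_eq_mul, hfσ,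
      sF, hττ, map_mul, map_sub, ha, hσσ]
    ring
  have hF₂ : ∀ m i, F₂ (τ m) i = σ (F₂ m i) := by
    intro m i
    simp only [F₂, LinearMap.add_apply, Pi.add_apply, hfσ, sF, hττ, map_add, hσσ]
    ring
  have hG₁ : ∀ x, τ (G₁ x) = G₁ (fun i => σ (x i)) := by
    intro x
    simp only [G₁, LinearMap.add_apply, map_add, hgσ]
    change τ (g x) + τ (τ (g (sF x))) = g (sF x) + τ (g (sF (sF x)))
    rw [hττ, sF_sF, add_comm]
  have hG₂ : ∀ x, τ (G₂ x) = G₂ (fun i => σ (x i)) := by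
    intro x
    simp only [G₂, LinearMap.smul_apply, LinearMap.sub_apply, hgσ]
    change τ (a • (g x - τ (g (sF x)))) = a • (g (sF x) - τ (g (sF (sF x))))
    rw [hτ, ha, map_sub, hττ, sF_sF, neg_smul, ← smul_neg, neg_sub]
  -- `4u ↦ 4ac`; restrict to invariants, then divide by the unit `4`
  have hu4 : algebraMap U V (4 * u) = 4 * (a * c) := by rw [map_mul, hu, map_ofNat]
  obtain ⟨t, f', g', h⟩ := exists_comp_eq_smul_id_fixed_of_equivariant σ hfix hinj τ j hjinj hjτ hjsurj
    F₁ F₂ G₁ G₂ hF₁ hF₂ hG₁ hG₂ hsum (4 * u) hu4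
  have h4 : IsUnit (4 : U) := by
    have : (4 : U) = 2 * 2 := by norm_num
    rw [this]; exact h2.mul h2
  obtain ⟨w, hw⟩ := h4
  refine ⟨t, (↑w⁻¹ : U) • f', g', ?_⟩
  rw [LinearMap.comp_smul, h, smul_smul]
  congr 1
  rw [← hw, Units.inv_mul_cancel_left]

/-- **Even (averaging) transfer (free form).** Same setting; a free `V`-factorisation `g ∘ f = c • id_M` with
`σ c = c` and two odd scalars `a, b` (`σ a = -a`, `σ b = -b`) yield a free `U`-factorisation of `u • id_N`
whenever `algebraMap U V u = a * b * c`: `g₊f₊ + g₋f₋ = c • id`, and `(ab) f₊`, `b f₋`, `a g₋`, `g₊` are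
equivariant.  (For `U = U_x(E₁₂)`: `(p,q,r)·(ca V)^σ ⊆ ca U`, stub-4 g2's averaging lemma.) [folklore] -/
theorem exists_comp_eq_smul_id_fixed_of_even (σ : V →ₐ[U] V) (hσσ : ∀ v, σ (σ v) = v)
    (hfix : ∀ v : V, σ v = v → ∃ u : U, algebraMap U V u = v) (hinj : Function.Injective (algebraMap U V))
    (h2 : IsUnit (2 : U)) (τ : M →+ M) (hτ : ∀ (v : V) (m : M), τ (v • m) = σ v • τ m)
    (hττ : ∀ m, τ (τ m) = m) (j : N →ₗ[U] M) (hjinj : Function.Injective j) (hjτ : ∀ n, τ (j n) = j n)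
    (hjsurj : ∀ m, τ m = m → ∃ n, j n = m) {c a b : V} (hc : σ c = c) (ha : σ a = -a) (hb : σ b = -b)
    {s : ℕ} (f : M →ₗ[V] (Fin s → V)) (g : (Fin s → V) →ₗ[V] M) (hgf : g ∘ₗ f = c • LinearMap.id) (u : U)
    (hu : algebraMap U V u = a * b * c) :
    ∃ (t : ℕ) (f' : N →ₗ[U] (Fin t → U)) (g' : (Fin t → U) →ₗ[U] N), g' ∘ₗ f' = u • LinearMap.id := by
  let fσ : M →ₗ[V] (Fin s → V) :=
    { toFun := fun m i => σ (f (τ m) i)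
      map_add' := fun m m' => by funext i; simp [map_add]
      map_smul' := fun v m => twist_source_map_smul σ hσσ τ hτ f v m }
  let sF : (Fin s → V) → (Fin s → V) := fun x i => σ (x i)
  have sF_add : ∀ x y, sF (x + y) = sF x + sF y := fun x y => by funext i; simp [sF]
  have sF_smul : ∀ (v : V) x, sF (v • x) = σ v • sF x := fun v x => by funext i; simp [sF]
  have sF_sF : ∀ x, sF (sF x) = x := fun x => by funext i; simp [sF, hσσ]
  let gσ : (Fin s → V) →ₗ[V] M :=
    { toFun := fun x => τ (g (sF x))
      map_add' := fun x y => by simp only [sF_add, map_add]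
      map_smul' := fun v x => by rw [sF_smul, map_smul, hτ, hσσ, RingHom.id_apply] }
  have hgf' : ∀ m, g (f m) = c • m := fun m => by
    simpa using LinearMap.congr_fun hgf m
  have hfσ : ∀ m, fσ m = sF (f (τ m)) := fun m => rfl
  have hgσ : ∀ x, gσ x = τ (g (sF x)) := fun x => rfl
  have hgσfσ : ∀ m, gσ (fσ m) = c • m := fun m => by
    rw [hfσ, hgσ, sF_sF, hgf', hτ, hττ, hc]
  let F₁ : M →ₗ[V] (Fin s → V) := (a * b) • (f + fσ)
  let G₁ : (Fin s → V) →ₗ[V] M := g + gσ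
  let F₂ : M →ₗ[V] (Fin s → V) := b • (f - fσ)
  let G₂ : (Fin s → V) →ₗ[V] M := a • (g - gσ)
  have hsum : ∀ m, G₁ (F₁ m) + G₂ (F₂ m) = (4 * (a * b * c)) • m := by
    intro m
    simp only [F₁, G₁, F₂, G₂, LinearMap.smul_apply, LinearMap.sub_apply, LinearMap.add_apply, map_smul,
      map_sub, map_add, smul_sub, smul_add, hgf', hgσfσ]
    module
  have hab : σ (a * b) = a * b := by rw [map_mul, ha, hb, neg_mul_neg]
  have hF₁ : ∀ m i, F₁ (τ m) i = σ (F₁ m i) := by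
    intro m i
    simp only [F₁, LinearMap.smul_apply, LinearMap.add_apply, Pi.smul_apply, Pi.add_apply, smul_eq_mul, hfσ,
      sF, hττ, map_mul, map_add, ha, hb, hσσ]
    ring
  have hF₂ : ∀ m i, F₂ (τ m) i = σ (F₂ m i) := by
    intro m i
    simp only [F₂, LinearMap.smul_apply, LinearMap.sub_apply, Pi.smul_apply, Pi.sub_apply, smul_eq_mul, hfσ,
      sF, hττ, map_mul, map_sub, hb, hσσ]
    ring
  have hG₁ : ∀ x, τ (G₁ x) = G₁ (fun i => σ (x i)) := by
    intro x
    simp only [G₁, LinearMap.add_apply, map_add, hgσ]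
    change τ (g x) + τ (τ (g (sF x))) = g (sF x) + τ (g (sF (sF x)))
    rw [hττ, sF_sF, add_comm]
  have hG₂ : ∀ x, τ (G₂ x) = G₂ (fun i => σ (x i)) := by
    intro x
    simp only [G₂, LinearMap.smul_apply, LinearMap.sub_apply, hgσ]
    change τ (a • (g x - τ (g (sF x)))) = a • (g (sF x) - τ (g (sF (sF x))))
    rw [hτ, ha, map_sub, hττ, sF_sF, neg_smul, ← smul_neg, neg_sub]
  have hu4 : algebraMap U V (4 * u) = 4 * (a * b * c) := by rw [map_mul, hu, map_ofNat]
  obtain ⟨t, f', g', h⟩ := exists_comp_eq_smul_id_fixed_of_equivariant σ hfix hinj τ j hjinj hjτ hjsurj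
    F₁ F₂ G₁ G₂ hF₁ hF₂ hG₁ hG₂ hsum (4 * u) hu4
  have h4 : IsUnit (4 : U) := by
    have : (4 : U) = 2 * 2 := by norm_num
    rw [this]; exact h2.mul h2
  obtain ⟨w, hw⟩ := h4
  refine ⟨t, (↑w⁻¹ : U) • f', g', ?_⟩
  rw [LinearMap.comp_smul, h, smul_smul]
  congr 1
  rw [← hw, Units.inv_mul_cancel_left]

/-- **Odd–odd transfer, CA-layer form**: `c` stably annihilates the `V`-module `M`, `σ c = -c`, `σ a = -a`,
`algebraMap U V u = a * c` ⟹ `u` stably annihilates the invariant `U`-module `N ≅ M^τ`.  With `c′ = t⁵ ∈ ca(V)`,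
`a = t` this is `r³ ∈ s̲ann_U(N)` for every MCM `N = M^{μ₂}` over `U = U_x(E₁₂)` (memo SIGMA6b §2). [folklore] -/
theorem StablyAnnihilates.fixed_of_anti (σ : V →ₐ[U] V) (hσσ : ∀ v, σ (σ v) = v)
    (hfix : ∀ v : V, σ v = v → ∃ u : U, algebraMap U V u = v) (hinj : Function.Injective (algebraMap U V))
    (h2 : IsUnit (2 : U)) (τ : M →+ M) (hτ : ∀ (v : V) (m : M), τ (v • m) = σ v • τ m)
    (hττ : ∀ m, τ (τ m) = m) (j : N →ₗ[U] M) (hjinj : Function.Injective j) (hjτ : ∀ n, τ (j n) = j n)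
    (hjsurj : ∀ m, τ m = m → ∃ n, j n = m) {c a : V} (hc : σ c = -c) (ha : σ a = -a)
    (h : StablyAnnihilates V c (ModuleCat.of V M)) (u : U) (hu : algebraMap U V u = a * c) :
    StablyAnnihilates U u (ModuleCat.of U N) := by
  obtain ⟨s, f, g, hgf⟩ := (stablyAnnihilates_iff_exists_linearMap c (ModuleCat.of V M)).mp h
  obtain ⟨t, f', g', h'⟩ := exists_comp_eq_smul_id_fixed_of_anti σ hσσ hfix hinj h2 τ hτ hττ j hjinj hjτ hjsurj
    hc ha f g hgf u hu
  exact stablyAnnihilates_of_linearMap f' g' h'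

/-- **Even (averaging) transfer, CA-layer form**: `c` stably annihilates `M`, `σ c = c`, `σ a = -a`, `σ b = -b`,
`algebraMap U V u = a * b * c` ⟹ `u` stably annihilates `N ≅ M^τ` (stub-4 g2's `(p,q,r)·(ca V ∩ U) ⊆ ca U` at
the level of one module). [folklore] -/
theorem StablyAnnihilates.fixed_of_even (σ : V →ₐ[U] V) (hσσ : ∀ v, σ (σ v) = v)
    (hfix : ∀ v : V, σ v = v → ∃ u : U, algebraMap U V u = v) (hinj : Function.Injective (algebraMap U V))
    (h2 : IsUnit (2 : U)) (τ : M →+ M) (hτ : ∀ (v : V) (m : M), τ (v • m) = σ v • τ m)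
    (hττ : ∀ m, τ (τ m) = m) (j : N →ₗ[U] M) (hjinj : Function.Injective j) (hjτ : ∀ n, τ (j n) = j n)
    (hjsurj : ∀ m, τ m = m → ∃ n, j n = m) {c a b : V} (hc : σ c = c) (ha : σ a = -a) (hb : σ b = -b)
    (h : StablyAnnihilates V c (ModuleCat.of V M)) (u : U) (hu : algebraMap U V u = a * b * c) :
    StablyAnnihilates U u (ModuleCat.of U N) := by
  obtain ⟨s, f, g, hgf⟩ := (stablyAnnihilates_iff_exists_linearMap c (ModuleCat.of V M)).mp h
  obtain ⟨t, f', g', h'⟩ := exists_comp_eq_smul_id_fixed_of_even σ hσσ hfix hinj h2 τ hτ hττ j hjinj hjτ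
    hjsurj hc ha hb f g hgf u hu
  exact stablyAnnihilates_of_linearMap f' g' h'

end Transfer

end Summit.ResolutionOfSingularities.ResolutionOfSingularities.Theorems.HomologicalConductor.PersistenceInvolutionTransfer
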